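import Summits.AtomisticToContinuum.FouriersLaw.Theorems.OddSectorIrreversibilityResponseDensityBackwardLimit

/-!
# The backward identity for Gibbs-weighted pairings of the pinned chain

Helper file for item stmt-AtomisticToContinuum-9144 (`ResponseDensity`, route
`OddSectorIrreversibility`, sub-problem `FouriersLaw` of `AtomisticToContinuum`).

**Main result** (`pinnedChain_gibbs_backward_identity`). For the transition kernels `P_t` of
`pinnedChain ω₂ lam β γ` (`ω₂, γ > 0`, `lam, β ≥ 0`, `N ≥ 1`) between baths at `T_L, T_R > 0`, an
exponent `θ` and an observable `φ ∈ C²` with `|φ| ≤ C e^{ϑH}`, `0 < ϑ < 1/max(T_L,T_R)`,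
`θ + ϑ < 0`, and every `t > 0`:

  `∫ e^{θH} P_t φ dx = e^{2γt} ( ∫ e^{θH} φ dx + ∫₀ᵗ e^{-2γs} ∫ P_s φ · L̂(e^{θH}) dx ds )`,

`L̂(e^{θH}) = γ e^{θH} (T_L(θ²p_0² + θ) + θp_0² + T_R(θ²p_{N-1}² + θ) + θp_{N-1}²)` the generator of
the momentum-reversed drift applied to the weight (`L̂ + 2γ = Lᵀ`, the Lebesgue transpose of the
generator `L`). This is the Kolmogorov backward equation `∂_t P_t = L P_t` integrated against the
weight `e^{θH}` with `L` moved onto the weight — obtained from the compactly supported case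
(`ConfinedBackward.lean`) by truncation `χ(H/R)` and dominated convergence (`R → ∞`).
No definitions.
-/

noncomputable section

open MeasureTheory ProbabilityTheory Filter Topology Set
open scoped NNReal ENNReal ContDiff

namespace Summit.AtomisticToContinuum.FouriersLaw.Theorems

open Literature.MathematicalPhysics.KineticTheory.HeatConduction
open Literature.Probability.Process Literature.MathematicalPhysics.KineticTheory OscillatorChain

variable {N : ℕ}

section Main

variable {ω₂ lam β γ : ℝ} (hω : 0 < ω₂) (hl : 0 ≤ lam) (hβ : 0 ≤ β) (hγ : 0 < γ)
  (hN : 0 < N) {T_L T_R : ℝ} (hTL : 0 < T_L) (hTR : 0 < T_R)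
  {ϑ : ℝ} (hϑ : 0 < ϑ) (hϑ' : ϑ < 1 / max T_L T_R) {θ : ℝ} (hθϑ : θ + ϑ < 0)
  {φ : PhaseSpace N → ℝ} (hφ2 : ContDiff ℝ 2 φ) {C : ℝ}
  (hφ : ∀ y, |φ y| ≤ C * Real.exp (ϑ * (pinnedChain ω₂ lam β γ).hamiltonian N y))
include hω hl hβ hγ hN hTL hTR hϑ hϑ' hθϑ hφ2 hφ

/-- **Limit of the time-integrated generator pairing**:
`∫₀ᵗ e^{-2γs} ∫ P_s(χ_R φ) L̂(χ_R e^{θH}) dx ds → ∫₀ᵗ e^{-2γs} ∫ P_s φ L̂(e^{θH}) dx ds`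
(`R = n + 1 → ∞`; dominated convergence on `(0, t]` with a constant majorant). -/
theorem tendsto_intervalIntegral_cutoff_gen (t : ℝ≥0) :
    Tendsto (fun n : ℕ => ∫ s in (0 : ℝ)..t, Real.exp (-(2 * γ * s)) *
        ∫ x, (∫ y, smoothCutoff ((pinnedChain ω₂ lam β γ).hamiltonian N y / (n + 1)) * φ y
            ∂((pinnedChain ω₂ lam β γ).transitionKernel N T_L T_R s.toNNReal x)) *
          sdeGenerator (fun y => -(pinnedChain ω₂ lam β γ).drift N y)
            ((pinnedChain ω₂ lam β γ).bathVecL N T_L) ((pinnedChain ω₂ lam β γ).bathVecR N T_R)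
            (fun y => smoothCutoff ((pinnedChain ω₂ lam β γ).hamiltonian N y / (n + 1)) *
              Real.exp (θ * (pinnedChain ω₂ lam β γ).hamiltonian N y)) x)
      atTop (𝓝 (∫ s in (0 : ℝ)..t, Real.exp (-(2 * γ * s)) *
        ∫ x, (∫ y, φ y ∂((pinnedChain ω₂ lam β γ).transitionKernel N T_L T_R s.toNNReal x)) *
          (Real.exp (θ * (pinnedChain ω₂ lam β γ).hamiltonian N x) *
            (γ * (T_L * (θ ^ 2 * x.2 ⟨0, hN⟩ ^ 2 + θ) + θ * x.2 ⟨0, hN⟩ ^ 2 +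
              (T_R * (θ ^ 2 * x.2 ⟨N - 1, by omega⟩ ^ 2 + θ) + θ * x.2 ⟨N - 1, by omega⟩ ^ 2)))))) := by
  have hφc : Continuous φ := hφ2.continuous
  obtain ⟨K, hK0, hK⟩ := exists_bound_cutoff_gen hω hl hβ hγ hN hTL hTR hϑ hϑ' hφ (θ := θ)
  have hIw := integrable_momentSq_mul_exp_mul_hamiltonian hω hl hβ γ hN hθϑ
  set Iw : ℝ := ∫ x : PhaseSpace N, (1 + x.2 ⟨0, hN⟩ ^ 2 + x.2 ⟨N - 1, by omega⟩ ^ 2) *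
    Real.exp ((θ + ϑ) * (pinnedChain ω₂ lam β γ).hamiltonian N x) with hIw_def
  have hIw0 : 0 ≤ Iw := integral_nonneg fun x => by positivity
  have hrate : 0 ≤ ϑ * γ * (T_L + T_R) := by positivity
  set M0 : ℝ := K * Real.exp (ϑ * γ * (T_L + T_R) * t) * Iw with hM0
  refine intervalIntegral.tendsto_integral_filter_of_dominated_convergence (fun _ => M0)
    (Eventually.of_forall fun n => ?_) (Eventually.of_forall fun n => Eventually.of_forall fun s hs => ?_)
    intervalIntegrable_const (Eventually.of_forall fun s hs => ?_)
  · exact ((Real.continuous_exp.comp (continuous_const.mul continuous_id).neg).mul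
      (continuous_pairing_truncPair hω hl hβ hγ T_L T_R θ hφ2
        (by positivity : (0:ℝ) < n + 1))).aestronglyMeasurable
  · rw [uIoc_of_le t.coe_nonneg] at hs
    have hs0 : 0 ≤ s := hs.1.le
    have hexp : Real.exp (-(2 * γ * s)) ≤ 1 := Real.exp_le_one_iff.2 (by nlinarith [hγ.le])
    -- the inner integral is bounded by `K e^{ϑγ(T_L+T_R)s} Iw ≤ K e^{ϑγ(T_L+T_R)t} Iw`
    have hin : ‖∫ x, (∫ y, smoothCutoff ((pinnedChain ω₂ lam β γ).hamiltonian N y / (n + 1)) * φ y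
            ∂((pinnedChain ω₂ lam β γ).transitionKernel N T_L T_R s.toNNReal x)) *
          sdeGenerator (fun y => -(pinnedChain ω₂ lam β γ).drift N y)
            ((pinnedChain ω₂ lam β γ).bathVecL N T_L) ((pinnedChain ω₂ lam β γ).bathVecR N T_R)
            (fun y => smoothCutoff ((pinnedChain ω₂ lam β γ).hamiltonian N y / (n + 1)) *
              Real.exp (θ * (pinnedChain ω₂ lam β γ).hamiltonian N y)) x‖ ≤
        K * Real.exp (ϑ * γ * (T_L + T_R) * s) * Iw := by
      rw [hIw_def, ← integral_const_mul]
      refine norm_integral_le_of_norm_le (hIw.const_mul _) (Eventually.of_forall fun x => ?_)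
      rw [Real.norm_eq_abs]
      have h := hK n s.toNNReal x
      rwa [Real.coe_toNNReal _ hs0] at h
    have hmono : K * Real.exp (ϑ * γ * (T_L + T_R) * s) * Iw ≤ M0 := by
      rw [hM0]
      refine mul_le_mul_of_nonneg_right (mul_le_mul_of_nonneg_left
        (Real.exp_le_exp.2 (mul_le_mul_of_nonneg_left hs.2 hrate)) hK0) hIw0
    rw [norm_mul, Real.norm_eq_abs, abs_of_pos (Real.exp_pos _)]
    calc Real.exp (-(2 * γ * s)) * _ ≤ 1 * (K * Real.exp (ϑ * γ * (T_L + T_R) * s) * Iw) :=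
          mul_le_mul hexp hin (norm_nonneg _) zero_le_one
      _ ≤ M0 := by rw [one_mul]; exact hmono
  · exact (tendsto_integral_cutoff_gen hω hl hβ hγ hN hTL hTR hϑ hϑ' hθϑ hφc hφ s.toNNReal).const_mul _

/-- **The backward identity for the Gibbs-weighted pairing of the pinned chain.** For `t > 0`:
`∫ e^{θH} P_t φ dx = e^{2γt} ( ∫ e^{θH} φ dx + ∫₀ᵗ e^{-2γs} ∫ P_s φ · L̂(e^{θH}) dx ds )` with
`L̂(e^{θH}) = γ e^{θH} (T_L(θ²p_0² + θ) + θp_0² + T_R(θ²p_{N-1}² + θ) + θp_{N-1}²)`. -/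
theorem pinnedChain_gibbs_backward_identity {t : ℝ≥0} (ht : 0 < t) :
    ∫ x, Real.exp (θ * (pinnedChain ω₂ lam β γ).hamiltonian N x) *
        ∫ y, φ y ∂((pinnedChain ω₂ lam β γ).transitionKernel N T_L T_R t x) =
      Real.exp (2 * γ * t) *
        ((∫ x, Real.exp (θ * (pinnedChain ω₂ lam β γ).hamiltonian N x) * φ x) +
          ∫ s in (0 : ℝ)..t, Real.exp (-(2 * γ * s)) *
            ∫ x, (∫ y, φ y ∂((pinnedChain ω₂ lam β γ).transitionKernel N T_L T_R s.toNNReal x)) *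
              (Real.exp (θ * (pinnedChain ω₂ lam β γ).hamiltonian N x) *
                (γ * (T_L * (θ ^ 2 * x.2 ⟨0, hN⟩ ^ 2 + θ) + θ * x.2 ⟨0, hN⟩ ^ 2 +
                  (T_R * (θ ^ 2 * x.2 ⟨N - 1, by omega⟩ ^ 2 + θ) +
                    θ * x.2 ⟨N - 1, by omega⟩ ^ 2))))) := by
  have hφc : Continuous φ := hφ2.continuous
  have hid := fun n : ℕ =>
    pinnedChain_truncated_backward_identity hω hl hβ hγ hN T_L T_R θ hφ2 n ht
  have ha := tendsto_integral_cutoff_lhs hω hl hβ hγ hN hTL hTR hϑ hϑ' hθϑ hφc hφ t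
  have hb := tendsto_integral_cutoff_diag hω hl hβ hθϑ hφc hφ (γ := γ)
  have hc := tendsto_intervalIntegral_cutoff_gen hω hl hβ hγ hN hTL hTR hϑ hϑ' hθϑ hφ2 hφ t
  have h2 := (hb.add hc).const_mul (Real.exp (2 * γ * t))
  simp_rw [← hid] at h2
  exact tendsto_nhds_unique ha h2


/-! ### The integrated (derivative) form -/

omit hN hTL hTR hϑ hϑ' hθϑ hφ2 hφ in
/-- The pair action of the truncated pair observable in kernel form:
`pairAct H_R s = ∫ χ_R e^{θH} · P_s(χ_R φ) dx`. -/
theorem pairAct_truncPair (R : ℝ) (s : ℝ≥0) :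
    pairAct ((pinnedChain ω₂ lam β γ).drift N) ((pinnedChain ω₂ lam β γ).bathVecL N T_L)
        ((pinnedChain ω₂ lam β γ).bathVecR N T_R) volume
        (fun p : PhaseSpace N × PhaseSpace N =>
          (smoothCutoff ((pinnedChain ω₂ lam β γ).hamiltonian N p.1 / R) *
              Real.exp (θ * (pinnedChain ω₂ lam β γ).hamiltonian N p.1)) *
            (smoothCutoff ((pinnedChain ω₂ lam β γ).hamiltonian N p.2 / R) * φ p.2)) s =
      ∫ x, (smoothCutoff ((pinnedChain ω₂ lam β γ).hamiltonian N x / R) *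
          Real.exp (θ * (pinnedChain ω₂ lam β γ).hamiltonian N x)) *
        ∫ y, smoothCutoff ((pinnedChain ω₂ lam β γ).hamiltonian N y / R) * φ y
          ∂((pinnedChain ω₂ lam β γ).transitionKernel N T_L T_R s x) := by
  rw [pairAct_def]
  simp only [integral_const_mul, pinnedChain_sdeKernel_eq_transitionKernel N T_L T_R hω hl hβ hγ.le]

omit hTL hTR hϑ hϑ' hθϑ hφ in
/-- **The truncated identity in integrated-derivative form**: for every `t ≥ 0`,
`∫ χ_R e^{θH} P_t(χ_R φ) dx - ∫ χ_R e^{θH} χ_R φ dx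
   = ∫₀ᵗ ( 2γ ∫ χ_R e^{θH} P_s(χ_R φ) dx + ∫ P_s(χ_R φ) L̂(χ_R e^{θH}) dx ) ds`
(fundamental theorem of calculus for `s ↦ pairAct H_R s`, whose derivative is
`pairAct (Lᵀ₁ H_R) = 2γ pairAct H_R + pairAct (L̂₁ H_R)`). -/
theorem pinnedChain_truncated_integrated_identity (n : ℕ) (t : ℝ≥0) :
    (∫ x, (smoothCutoff ((pinnedChain ω₂ lam β γ).hamiltonian N x / (n + 1)) *
          Real.exp (θ * (pinnedChain ω₂ lam β γ).hamiltonian N x)) *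
        ∫ y, smoothCutoff ((pinnedChain ω₂ lam β γ).hamiltonian N y / (n + 1)) * φ y
          ∂((pinnedChain ω₂ lam β γ).transitionKernel N T_L T_R t x)) -
      ∫ x, (smoothCutoff ((pinnedChain ω₂ lam β γ).hamiltonian N x / (n + 1)) *
          Real.exp (θ * (pinnedChain ω₂ lam β γ).hamiltonian N x)) *
        (smoothCutoff ((pinnedChain ω₂ lam β γ).hamiltonian N x / (n + 1)) * φ x) =
      ∫ s in (0 : ℝ)..t,
        (2 * γ * (∫ x, (smoothCutoff ((pinnedChain ω₂ lam β γ).hamiltonian N x / (n + 1)) *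
            Real.exp (θ * (pinnedChain ω₂ lam β γ).hamiltonian N x)) *
            ∫ y, smoothCutoff ((pinnedChain ω₂ lam β γ).hamiltonian N y / (n + 1)) * φ y
              ∂((pinnedChain ω₂ lam β γ).transitionKernel N T_L T_R s.toNNReal x)) +
          ∫ x, (∫ y, smoothCutoff ((pinnedChain ω₂ lam β γ).hamiltonian N y / (n + 1)) * φ y
              ∂((pinnedChain ω₂ lam β γ).transitionKernel N T_L T_R s.toNNReal x)) *
            sdeGenerator (fun y => -(pinnedChain ω₂ lam β γ).drift N y)
              ((pinnedChain ω₂ lam β γ).bathVecL N T_L) ((pinnedChain ω₂ lam β γ).bathVecR N T_R)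
              (fun y => smoothCutoff ((pinnedChain ω₂ lam β γ).hamiltonian N y / (n + 1)) *
                Real.exp (θ * (pinnedChain ω₂ lam β γ).hamiltonian N y)) x) := by
  haveI := isAddHaarMeasure_volume_phaseSpace N
  set P := pinnedChain ω₂ lam β γ with hP
  have hPc : P.IsConfining := SubdiffusiveBondHeat.pinnedChain_isConfining hω hl hβ hγ.le
  have hU : ContDiff ℝ ∞ P.U := pinnedChain_contDiff_U ω₂ lam β γ
  have hV : ContDiff ℝ ∞ P.V := pinnedChain_contDiff_V ω₂ lam β γ
  have hY'c : Continuous fun y => -P.drift N y := (P.contDiff_drift hU hV N).continuous.neg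
  have hR : (0 : ℝ) < n + 1 := by positivity
  have hHn2 := contDiff_truncPair ω₂ lam β γ N θ (n + 1) hφ2
  have hHnc := hasCompactSupport_truncPair γ N θ hω hl hβ φ hR
  set D := (hPc.confinedDrift N).toConfinedDrift with hD
  -- the pair action as a function of real time, its derivative and their continuity
  have hFc := D.continuous_pairAct (hPc.bathVecL_mem_noise N T_L) (hPc.bathVecR_mem_noise N T_R)
    volume hHn2.continuous hHnc
  have hLc := D.continuous_pairAct (hPc.bathVecL_mem_noise N T_L) (hPc.bathVecR_mem_noise N T_R)
    volume (continuous_sdeGeneratorFst (v₁ := P.bathVecL N T_L) (v₂ := P.bathVecR N T_R) hY'c hHn2)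
    (hasCompactSupport_sdeGeneratorFst (Y' := fun y => -P.drift N y) (v₁ := P.bathVecL N T_L)
      (v₂ := P.bathVecR N T_R) hHnc)
  have hderiv := fun (s : ℝ) (hs : 0 < s) => D.hasDerivAt_pairAct
    (hPc.bathVecL_mem_noise N T_L) (hPc.bathVecR_mem_noise N T_R) volume (hPc.reversedDrift N)
    (hPc.bathVecL_mem_reversedDrift_noise N T_L) (hPc.bathVecR_mem_reversedDrift_noise N T_R)
    (fun _ => rfl) (P.trace_fderiv_drift hU hV hN) hHn2 hHnc hs
  -- fundamental theorem of calculus on `[0, t]`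
  have hftc := intervalIntegral.integral_eq_sub_of_hasDerivAt_of_le t.coe_nonneg
    (hFc.continuousOn) (fun s hs => hderiv s hs.1)
    (((continuous_const.mul hFc).add hLc).intervalIntegrable _ _)
  -- rewrite everything in kernel form
  simp only [Real.toNNReal_coe, Real.toNNReal_zero] at hftc
  rw [pairAct_truncPair hω hl hβ hγ (T_L := T_L) (T_R := T_R) (θ := θ) (φ := φ) (n + 1) t,
    pairAct_truncPair hω hl hβ hγ (T_L := T_L) (T_R := T_R) (θ := θ) (φ := φ) (n + 1) 0,
    pinnedChain_transitionKernel_zero hω hl hβ hγ.le N T_L T_R] at hftc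
  simp only [ProbabilityTheory.Kernel.id_apply, integral_dirac] at hftc
  rw [← hftc]
  refine intervalIntegral.integral_congr fun s _ => ?_
  rw [pairAct_truncPair hω hl hβ hγ (T_L := T_L) (T_R := T_R) (θ := θ) (φ := φ) (n + 1),
    pairAct_sdeGeneratorFst_truncPair hω hl hβ hγ T_L T_R θ (n + 1) φ,
    show P.γ = γ from rfl]
  ring

omit hθϑ hφ2 in
/-- Uniform majorant of the left-hand integrand: `|χ_R e^{θH}(x) P_s(χ_R φ)(x)| ≤
C e^{ϑγ(T_L+T_R)s} e^{(θ+ϑ)H(x)}`. -/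
theorem abs_cutoff_lhs_integrand_le (n : ℕ) (s : ℝ≥0) (x : PhaseSpace N) :
    |(smoothCutoff ((pinnedChain ω₂ lam β γ).hamiltonian N x / (n + 1)) *
          Real.exp (θ * (pinnedChain ω₂ lam β γ).hamiltonian N x)) *
        ∫ y, smoothCutoff ((pinnedChain ω₂ lam β γ).hamiltonian N y / (n + 1)) * φ y
          ∂((pinnedChain ω₂ lam β γ).transitionKernel N T_L T_R s x)| ≤
      C * Real.exp (ϑ * γ * (T_L + T_R) * s) *
        Real.exp ((θ + ϑ) * (pinnedChain ω₂ lam β γ).hamiltonian N x) := by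
  have hin := pinnedChain_abs_integral_kernel_le hω hl hβ hγ hN hTL hTR hϑ hϑ' hφ s x
    (g := fun y => smoothCutoff ((pinnedChain ω₂ lam β γ).hamiltonian N y / (n + 1))) (fun y => by
      rw [abs_of_nonneg (smoothCutoff_nonneg _)]; exact smoothCutoff_le_one _)
  rw [abs_mul, show (θ + ϑ) * (pinnedChain ω₂ lam β γ).hamiltonian N x =
    θ * (pinnedChain ω₂ lam β γ).hamiltonian N x + ϑ * (pinnedChain ω₂ lam β γ).hamiltonian N x by ring,
    Real.exp_add]
  calc _ ≤ Real.exp (θ * (pinnedChain ω₂ lam β γ).hamiltonian N x) *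
        (C * (Real.exp (ϑ * γ * (T_L + T_R) * s) *
          Real.exp (ϑ * (pinnedChain ω₂ lam β γ).hamiltonian N x))) :=
        mul_le_mul (abs_cutoffExp_le θ _ _) hin (abs_nonneg _) (Real.exp_pos _).le
    _ = _ := by ring

/-- **The backward identity for the Gibbs-weighted pairing, integrated form.** For every `t ≥ 0`:
`∫ e^{θH} P_t φ dx - ∫ e^{θH} φ dx = ∫₀ᵗ ( 2γ ∫ e^{θH} P_s φ dx + ∫ P_s φ · L̂(e^{θH}) dx ) ds`,
i.e. `∫ e^{θH} P_t φ dx - ∫ e^{θH} φ dx = ∫₀ᵗ ∫ P_s φ · Lᵀ(e^{θH}) dx ds` with `Lᵀ = L̂ + 2γ` the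
Lebesgue transpose of the generator — the weak backward Kolmogorov equation tested against `e^{θH}`. -/
theorem pinnedChain_gibbs_backward_identity_integral (t : ℝ≥0) :
    (∫ x, Real.exp (θ * (pinnedChain ω₂ lam β γ).hamiltonian N x) *
        ∫ y, φ y ∂((pinnedChain ω₂ lam β γ).transitionKernel N T_L T_R t x)) -
      ∫ x, Real.exp (θ * (pinnedChain ω₂ lam β γ).hamiltonian N x) * φ x =
      ∫ s in (0 : ℝ)..t,
        (2 * γ * (∫ x, Real.exp (θ * (pinnedChain ω₂ lam β γ).hamiltonian N x) *
            ∫ y, φ y ∂((pinnedChain ω₂ lam β γ).transitionKernel N T_L T_R s.toNNReal x)) +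
          ∫ x, (∫ y, φ y ∂((pinnedChain ω₂ lam β γ).transitionKernel N T_L T_R s.toNNReal x)) *
            (Real.exp (θ * (pinnedChain ω₂ lam β γ).hamiltonian N x) *
              (γ * (T_L * (θ ^ 2 * x.2 ⟨0, hN⟩ ^ 2 + θ) + θ * x.2 ⟨0, hN⟩ ^ 2 +
                (T_R * (θ ^ 2 * x.2 ⟨N - 1, by omega⟩ ^ 2 + θ) +
                  θ * x.2 ⟨N - 1, by omega⟩ ^ 2))))) := by
  have hφc : Continuous φ := hφ2.continuous
  have hid := fun n : ℕ =>
    pinnedChain_truncated_integrated_identity hω hl hβ hγ hN hφ2 (T_L := T_L) (T_R := T_R)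
      (θ := θ) n t
  have ha := tendsto_integral_cutoff_lhs hω hl hβ hγ hN hTL hTR hϑ hϑ' hθϑ hφc hφ t
  have hb := tendsto_integral_cutoff_diag hω hl hβ hθϑ hφc hφ (γ := γ)
  -- the time integral: dominated convergence with a constant majorant on `(0, t]`
  have hC : 0 ≤ C := by
    have := (abs_nonneg _).trans (hφ 0)
    exact nonneg_of_mul_nonneg_left this (Real.exp_pos _)
  obtain ⟨K, hK0, hK⟩ := exists_bound_cutoff_gen hω hl hβ hγ hN hTL hTR hϑ hϑ' hφ (θ := θ)
  have hI₁ := integrable_exp_mul_hamiltonian hω hl hβ γ (N := N) hθϑ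
  have hIw := integrable_momentSq_mul_exp_mul_hamiltonian hω hl hβ γ hN hθϑ
  set I₁ : ℝ := ∫ x : PhaseSpace N, Real.exp ((θ + ϑ) * (pinnedChain ω₂ lam β γ).hamiltonian N x)
    with hI₁_def
  set Iw : ℝ := ∫ x : PhaseSpace N, (1 + x.2 ⟨0, hN⟩ ^ 2 + x.2 ⟨N - 1, by omega⟩ ^ 2) *
    Real.exp ((θ + ϑ) * (pinnedChain ω₂ lam β γ).hamiltonian N x) with hIw_def
  have hI₁0 : 0 ≤ I₁ := integral_nonneg fun x => (Real.exp_pos _).le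
  have hIw0 : 0 ≤ Iw := integral_nonneg fun x => by positivity
  have hrate : 0 ≤ ϑ * γ * (T_L + T_R) := by positivity
  set M0 : ℝ := Real.exp (ϑ * γ * (T_L + T_R) * t) * (2 * γ * (C * I₁) + K * Iw) with hM0
  have hc : Tendsto (fun n : ℕ => ∫ s in (0 : ℝ)..t,
      (2 * γ * (∫ x, (smoothCutoff ((pinnedChain ω₂ lam β γ).hamiltonian N x / (n + 1)) *
          Real.exp (θ * (pinnedChain ω₂ lam β γ).hamiltonian N x)) *
          ∫ y, smoothCutoff ((pinnedChain ω₂ lam β γ).hamiltonian N y / (n + 1)) * φ y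
            ∂((pinnedChain ω₂ lam β γ).transitionKernel N T_L T_R s.toNNReal x)) +
        ∫ x, (∫ y, smoothCutoff ((pinnedChain ω₂ lam β γ).hamiltonian N y / (n + 1)) * φ y
            ∂((pinnedChain ω₂ lam β γ).transitionKernel N T_L T_R s.toNNReal x)) *
          sdeGenerator (fun y => -(pinnedChain ω₂ lam β γ).drift N y)
            ((pinnedChain ω₂ lam β γ).bathVecL N T_L) ((pinnedChain ω₂ lam β γ).bathVecR N T_R)
            (fun y => smoothCutoff ((pinnedChain ω₂ lam β γ).hamiltonian N y / (n + 1)) *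
              Real.exp (θ * (pinnedChain ω₂ lam β γ).hamiltonian N y)) x)) atTop
      (𝓝 (∫ s in (0 : ℝ)..t,
        (2 * γ * (∫ x, Real.exp (θ * (pinnedChain ω₂ lam β γ).hamiltonian N x) *
            ∫ y, φ y ∂((pinnedChain ω₂ lam β γ).transitionKernel N T_L T_R s.toNNReal x)) +
          ∫ x, (∫ y, φ y ∂((pinnedChain ω₂ lam β γ).transitionKernel N T_L T_R s.toNNReal x)) *
            (Real.exp (θ * (pinnedChain ω₂ lam β γ).hamiltonian N x) *
              (γ * (T_L * (θ ^ 2 * x.2 ⟨0, hN⟩ ^ 2 + θ) + θ * x.2 ⟨0, hN⟩ ^ 2 +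
                (T_R * (θ ^ 2 * x.2 ⟨N - 1, by omega⟩ ^ 2 + θ) +
                  θ * x.2 ⟨N - 1, by omega⟩ ^ 2))))))) := by
    haveI := isAddHaarMeasure_volume_phaseSpace N
    have hPc : (pinnedChain ω₂ lam β γ).IsConfining := SubdiffusiveBondHeat.pinnedChain_isConfining hω hl hβ hγ.le
    refine intervalIntegral.tendsto_integral_filter_of_dominated_convergence (fun _ => M0)
      (Eventually.of_forall fun n => ?_)
      (Eventually.of_forall fun n => Eventually.of_forall fun s hs => ?_)
      intervalIntegrable_const (Eventually.of_forall fun s hs => ?_)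
    · have hR : (0 : ℝ) < n + 1 := by positivity
      have h1 : Continuous fun s : ℝ =>
          ∫ x, (smoothCutoff ((pinnedChain ω₂ lam β γ).hamiltonian N x / (n + 1)) *
            Real.exp (θ * (pinnedChain ω₂ lam β γ).hamiltonian N x)) *
            ∫ y, smoothCutoff ((pinnedChain ω₂ lam β γ).hamiltonian N y / (n + 1)) * φ y
              ∂((pinnedChain ω₂ lam β γ).transitionKernel N T_L T_R s.toNNReal x) := by
        simp_rw [← pairAct_truncPair hω hl hβ hγ (T_L := T_L) (T_R := T_R) (θ := θ) (φ := φ) (n + 1)]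
        exact (hPc.confinedDrift N).toConfinedDrift.continuous_pairAct
          (hPc.bathVecL_mem_noise N T_L) (hPc.bathVecR_mem_noise N T_R) volume
          (contDiff_truncPair ω₂ lam β γ N θ (n + 1) hφ2).continuous
          (hasCompactSupport_truncPair γ N θ hω hl hβ φ hR)
      exact ((continuous_const.mul h1).add
        (continuous_pairing_truncPair hω hl hβ hγ T_L T_R θ hφ2 hR)).aestronglyMeasurable
    · rw [uIoc_of_le t.coe_nonneg] at hs
      have hs0 : 0 ≤ s := hs.1.le
      have hexp : Real.exp (ϑ * γ * (T_L + T_R) * s) ≤ Real.exp (ϑ * γ * (T_L + T_R) * t) :=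
        Real.exp_le_exp.2 (mul_le_mul_of_nonneg_left hs.2 hrate)
      have h1 : ‖∫ x, (smoothCutoff ((pinnedChain ω₂ lam β γ).hamiltonian N x / (n + 1)) *
            Real.exp (θ * (pinnedChain ω₂ lam β γ).hamiltonian N x)) *
            ∫ y, smoothCutoff ((pinnedChain ω₂ lam β γ).hamiltonian N y / (n + 1)) * φ y
              ∂((pinnedChain ω₂ lam β γ).transitionKernel N T_L T_R s.toNNReal x)‖ ≤
          C * Real.exp (ϑ * γ * (T_L + T_R) * s) * I₁ := by
        rw [hI₁_def, ← integral_const_mul]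
        refine norm_integral_le_of_norm_le (hI₁.const_mul _) (Eventually.of_forall fun x => ?_)
        rw [Real.norm_eq_abs]
        have h := abs_cutoff_lhs_integrand_le hω hl hβ hγ hN hTL hTR hϑ hϑ' hφ (θ := θ) n s.toNNReal x
        rwa [Real.coe_toNNReal _ hs0] at h
      have h2 : ‖∫ x, (∫ y, smoothCutoff ((pinnedChain ω₂ lam β γ).hamiltonian N y / (n + 1)) * φ y
              ∂((pinnedChain ω₂ lam β γ).transitionKernel N T_L T_R s.toNNReal x)) *
            sdeGenerator (fun y => -(pinnedChain ω₂ lam β γ).drift N y)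
              ((pinnedChain ω₂ lam β γ).bathVecL N T_L) ((pinnedChain ω₂ lam β γ).bathVecR N T_R)
              (fun y => smoothCutoff ((pinnedChain ω₂ lam β γ).hamiltonian N y / (n + 1)) *
                Real.exp (θ * (pinnedChain ω₂ lam β γ).hamiltonian N y)) x‖ ≤
          K * Real.exp (ϑ * γ * (T_L + T_R) * s) * Iw := by
        rw [hIw_def, ← integral_const_mul]
        refine norm_integral_le_of_norm_le (hIw.const_mul _) (Eventually.of_forall fun x => ?_)
        rw [Real.norm_eq_abs]
        have h := hK n s.toNNReal x
        rwa [Real.coe_toNNReal _ hs0] at h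
      calc _ ≤ ‖2 * γ * (∫ x, (smoothCutoff ((pinnedChain ω₂ lam β γ).hamiltonian N x / (n + 1)) *
              Real.exp (θ * (pinnedChain ω₂ lam β γ).hamiltonian N x)) *
              ∫ y, smoothCutoff ((pinnedChain ω₂ lam β γ).hamiltonian N y / (n + 1)) * φ y
                ∂((pinnedChain ω₂ lam β γ).transitionKernel N T_L T_R s.toNNReal x))‖ + _ :=
            norm_add_le _ _
        _ ≤ 2 * γ * (C * Real.exp (ϑ * γ * (T_L + T_R) * s) * I₁) +
            K * Real.exp (ϑ * γ * (T_L + T_R) * s) * Iw := by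
            refine add_le_add ?_ h2
            rw [norm_mul, Real.norm_eq_abs, abs_of_pos (by positivity : (0:ℝ) < 2 * γ)]
            exact mul_le_mul_of_nonneg_left h1 (by positivity)
        _ ≤ M0 := by
            rw [hM0]
            have hCI : 0 ≤ C * I₁ := mul_nonneg hC hI₁0
            have hKI : 0 ≤ K * Iw := mul_nonneg hK0 hIw0
            nlinarith [mul_le_mul_of_nonneg_left hexp hCI, mul_le_mul_of_nonneg_left hexp hKI,
              hγ.le, mul_nonneg hγ.le hCI]
    · exact ((tendsto_integral_cutoff_lhs hω hl hβ hγ hN hTL hTR hϑ hϑ' hθϑ hφc hφ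
          s.toNNReal).const_mul (2 * γ)).add
        (tendsto_integral_cutoff_gen hω hl hβ hγ hN hTL hTR hϑ hϑ' hθϑ hφc hφ s.toNNReal)
  have h2 := ha.sub hb
  simp_rw [hid] at h2
  exact (tendsto_nhds_unique h2 hc)
end Main

end Summit.AtomisticToContinuum.FouriersLaw.Theorems

end
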